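import Mathlib.LinearAlgebra.Matrix.Transvection
import Mathlib.LinearAlgebra.Matrix.Permutation
import Mathlib.LinearAlgebra.Matrix.GeneralLinearGroup.Defs
import Mathlib.LinearAlgebra.Matrix.SpecialLinearGroup
import Mathlib.FieldTheory.IsAlgClosed.Basic
import Mathlib.Analysis.Complex.Polynomial.Basic
import Mathlib.GroupTheory.OrderOfElement
import Mathlib.Algebra.Group.Pi.Units
import Mathlib.RingTheory.UniqueFactorizationDomain.Finite
import Mathlib.RingTheory.Polynomial.UniqueFactorization
import Mathlib.Algebra.MvPolynomial.Nilpotent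
import Mathlib.Algebra.MvPolynomial.NoZeroDivisors
import Literature.Computability.AlgebraicComplexity.BI17HoweInvariantsProofs
import HarnessLib

/-!
# Bürgisser–Ikenmeyer 2017, Lemma 3.19 — Cayley's invariant `P_{D,m}` is irreducible (`D` even):
# discharge, via Howe's theorem and "divisors of semi-invariants are semi-invariants"

P. Bürgisser, C. Ikenmeyer, *Fundamental invariants of orbit closures*, J. Algebra **477** (2017)
390–434 = arXiv:1511.02927 [BurgisserIkenmeyer2017], §3.2, Lemma 3.19 (`\label{le:irred}`,
`main.tex` L1232–1241; held text `paper:arxiv-1511.02927`, p0011:L70): "`P_{D,m}` is an irreducible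
polynomial of degree `m` if `D` is even. Proof. This can be directly derived from the fact that, by
Theorem 3.14 [Howe], `P_{D,m}` is a nonzero `SL_m`-invariant on `Sym^D ℂ^m` of smallest degree. For an
analog argument see for example [Ottaviani 2009, p. 105]." Theorem-only companion of the file of
record `BI17FundamentalInvariantForms.lean` (val-lit row BI17-A, t04), which types Lemma 3.19 as the
named fact `BI2017_lem_3_19`; this file DISCHARGES it (`BI2017_lem_3_19_holds`), consuming Howe's
theorem as the tree's `BI2017_thm_3_14_holds` (`BI17HoweInvariantsProofs.lean`, val-lit t01).

The "analog argument" made explicit (the classical lemma that the factors of a semi-invariant of a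
connected group are semi-invariants, here for `GL_m(ℂ)` acting on `ℂ[Sym^D ℂ^m]` by `coordSubst`):
* `GL_monoidHom_eq_one_of_finite` — a homomorphism from `GL_m(ℂ)` to a finite group is trivial
  (transvections and invertible diagonal matrices are `N`-th powers for every `N`; generation by
  `Matrix.diagonal_transvection_induction_of_det_ne_zero`).
* `GL_monoidHom_comm_apply_toGL_eq_one` — a homomorphism from `GL_m(ℂ)` to a commutative group kills
  `SL_m(ℂ)` (`t_{ij}(s)` is conjugate to `t_{ij}(2s) = t_{ij}(s)²`; one-entry diagonal matrices at
  different positions are conjugate by permutation matrices; `Matrix.diagonal_transvection_induction`).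
* `associated_coordSubst_of_dvd` — if `g · P ~ P` for all `g ∈ GL_m(ℂ)` (`P ≠ 0`), then `g · a ~ a`
  for every divisor `a` of `P`: `GL_m(ℂ)` permutes the finite set of divisor classes of `P`
  (`UniqueFactorizationMonoid.fintypeSubtypeDvd` in `Associates ℂ[Sym^D]`), trivially by the first
  bullet.
* `isSLInvariantCoord_of_forall_associated_coordSubst` — then `a` is `SL_m`-invariant: the units
  `g · a = c_g a` form a homomorphism `GL_m(ℂ) → ℂ^×`, trivial on `SL_m(ℂ)` by the second bullet.
* `coordSubst_cayleyP` — `P_{D,m}` is such a `P`: `g · P_{D,m} = det(g⁻¹)^D P_{D,m}` as a polynomial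
  identity (Thm. 3.18(1), tree `BI2017_thm_3_18_1`, at every point; `MvPolynomial.funext`).
* `IsSLInvariantCoord.homogeneousComponent` — homogeneous components of `SL_m`-invariants are
  invariant (the action is graded, tree `isHomogeneous_coordSubst`).
* `BI2017_lem_3_19_holds` — if `P_{D,m} = a b` with `a`, `b` non-units, a nonzero homogeneous component
  of `a` of degree `0 < i ≤ deg a < m` is a nonzero element of `O(Sym^D ℂ^m)^{SL_m}_i = 0` (Howe),
  contradiction; `P_{D,m} ≠ 0` by Thm. 3.18(2) (`BI2017_thm_3_18_2_powerSum`), not a unit as it is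
  homogeneous of degree `m ≥ 1`. (`m = 1`: the degree count alone.)

No new definitions; no facts introduced. Honest framing: proofs of published statements about
invariants of forms; nothing here bears on VP versus VNP.

## References

* [BurgisserIkenmeyer2017] P. Bürgisser, C. Ikenmeyer, *Fundamental invariants of orbit closures*,
  J. Algebra 477 (2017) 390–434; arXiv:1511.02927, §3.2 Lemma 3.19, Thm. 3.14, Thm. 3.18.
* G. Ottaviani, *An invariant regarding Waring's problem for cubic polynomials*, Nagoya Math. J. 193
  (2009), p. 105 (the analogous irreducibility argument cited by BI).
-/

namespace Literature.Computability.AlgebraicComplexity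

open _root_.Matrix

section GLHoms

variable {m : ℕ}

/-- Powers of a transvection: `t_{ij}(c)^N = t_{ij}(N c)`. [folklore] -/
private theorem transvection_pow {R : Type*} [CommRing R] {i j : Fin m} (h : i ≠ j) (c : R)
    (N : ℕ) : (transvection i j c) ^ N = transvection i j (N * c) := by
  induction N with
  | zero => simp
  | succ N ih =>
    rw [pow_succ, ih, transvection_mul_transvection_same i j h]
    congr 1
    push_cast
    ring

/-- **Every homomorphism from `GL_m(ℂ)` to a finite group is trivial**: transvections and
invertible diagonal matrices are `N`-th powers in `GL_m(ℂ)` for every `N ≥ 1` (`ℂ` is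
algebraically closed), hence are killed (`x ^ |G| = 1`), and they generate
(`Matrix.diagonal_transvection_induction_of_det_ne_zero`). A standard fact (`GL_m(ℂ)` has no
nontrivial finite quotient), proved here as the group-theoretic input of BI 2017 Lemma 3.19
("factors of a semi-invariant of a connected group are semi-invariants").
[cite: BurgisserIkenmeyer2017, Lemma 3.19 (proof)] -/
theorem GL_monoidHom_eq_one_of_finite {G : Type*} [Group G] [Finite G]
    (π : GL (Fin m) ℂ →* G) (g : GL (Fin m) ℂ) : π g = 1 := by
  classical
  haveI := Fintype.ofFinite G
  have hN0 : 0 < Fintype.card G := Fintype.card_pos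
  have hpow : ∀ h : GL (Fin m) ℂ, π (h ^ Fintype.card G) = 1 := fun h => by
    rw [map_pow, pow_card_eq_one]
  suffices H : ∀ (M : Matrix (Fin m) (Fin m) ℂ) (hM : M.det ≠ 0),
      π (Matrix.GeneralLinearGroup.mkOfDetNeZero M hM) = 1 by
    have hg : Matrix.GeneralLinearGroup.mkOfDetNeZero (g : Matrix (Fin m) (Fin m) ℂ)
        g.det_ne_zero = g := Units.ext rfl
    rw [← hg]
    exact H _ _
  intro M hM
  refine Matrix.diagonal_transvection_induction_of_det_ne_zero
    (fun M => ∀ hM : M.det ≠ 0, π (Matrix.GeneralLinearGroup.mkOfDetNeZero M hM) = 1)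
    M hM ?_ ?_ ?_ hM
  · intro D hD hD'
    have hDi : ∀ i, D i ≠ 0 := by
      intro i hi
      apply hD
      rw [det_diagonal]
      exact Finset.prod_eq_zero (Finset.mem_univ i) hi
    choose r hr using fun i => IsAlgClosed.exists_pow_nat_eq (D i) hN0
    have hri : ∀ i, r i ≠ 0 := fun i hi => hDi i (by rw [← hr i, hi, zero_pow hN0.ne'])
    have hdet : (diagonal r).det ≠ 0 := by
      rw [det_diagonal]
      exact Finset.prod_ne_zero_iff.mpr fun i _ => hri i
    have heq : Matrix.GeneralLinearGroup.mkOfDetNeZero (diagonal D) hD' =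
        (Matrix.GeneralLinearGroup.mkOfDetNeZero (diagonal r) hdet) ^ Fintype.card G := by
      apply Units.ext
      rw [Units.val_pow_eq_pow_val]
      change diagonal D = (diagonal r) ^ Fintype.card G
      rw [diagonal_pow]
      congr 1
      funext i
      exact (hr i).symm
    rw [heq]
    exact hpow _
  · intro t hM'
    have hdet : (transvection t.i t.j (t.c / Fintype.card G)).det ≠ 0 := by
      rw [det_transvection_of_ne _ _ t.hij]
      exact one_ne_zero
    have heq : Matrix.GeneralLinearGroup.mkOfDetNeZero t.toMatrix hM' =
        (Matrix.GeneralLinearGroup.mkOfDetNeZero (transvection t.i t.j (t.c / Fintype.card G))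
          hdet) ^ Fintype.card G := by
      apply Units.ext
      rw [Units.val_pow_eq_pow_val]
      change t.toMatrix = (transvection t.i t.j (t.c / Fintype.card G)) ^ Fintype.card G
      rw [transvection_pow t.hij, TransvectionStruct.toMatrix]
      congr 1
      have : (Fintype.card G : ℂ) ≠ 0 := Nat.cast_ne_zero.mpr hN0.ne'
      field_simp
    rw [heq]
    exact hpow _
  · intro A B hA hB hPA hPB hAB
    have heq : Matrix.GeneralLinearGroup.mkOfDetNeZero (A * B) hAB =
        Matrix.GeneralLinearGroup.mkOfDetNeZero A hA *
          Matrix.GeneralLinearGroup.mkOfDetNeZero B hB :=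
      Units.ext rfl
    rw [heq, map_mul, hPA hA, hPB hB, one_mul]

/-- A diagonal matrix past a transvection: `diag(u) t_{ij}(s) = t_{ij}(u_i s u_j⁻¹) diag(u)`, here
with `u = (1,…,2,…,1)` (`2` at `i`): `diag(u) t_{ij}(s) = t_{ij}(2s) diag(u)`. [folklore] -/
private theorem diagonal_update_two_mul_transvection {i j : Fin m} (h : i ≠ j) (s : ℂ) :
    diagonal (Function.update (1 : Fin m → ℂ) i 2) * transvection i j s =
      transvection i j (2 * s) * diagonal (Function.update (1 : Fin m → ℂ) i 2) := by
  ext a b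
  rw [diagonal_mul, mul_diagonal]
  simp only [transvection, Matrix.add_apply, Matrix.one_apply, Matrix.single_apply,
    Function.update_apply, Pi.one_apply]
  by_cases hab : a = b
  · subst hab
    have hija : ¬ (i = a ∧ j = a) := fun hh => h (hh.1.trans hh.2.symm)
    simp [hija]
  · rw [if_neg hab]
    by_cases hij : i = a ∧ j = b
    · obtain ⟨rfl, rfl⟩ := hij
      simp [h.symm, mul_comm]
    · simp [hij]


/-- A permutation matrix past a diagonal matrix: `P_σ diag(d) = diag(d ∘ σ) P_σ`. [folklore] -/
private theorem permMatrix_mul_diagonal {R : Type*} [CommRing R] (σ : Equiv.Perm (Fin m))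
    (d : Fin m → R) :
    σ.permMatrix R * diagonal d = diagonal (d ∘ σ) * σ.permMatrix R := by
  ext a b
  simp only [Equiv.Perm.permMatrix, PEquiv.toMatrix_toPEquiv_mul, PEquiv.mul_toMatrix_toPEquiv,
    submatrix_apply, id, diagonal_apply, Function.comp_apply]
  by_cases hab : σ a = b
  · subst hab
    simp
  · have hb : a ≠ σ.symm b := fun h' => hab (by rw [h', Equiv.apply_symm_apply])
    rw [if_neg hab, if_neg hb]

/-- **Every homomorphism from `GL_m(ℂ)` to a commutative group is trivial on `SL_m(ℂ)`**
(`SL_m(ℂ) ≤ [GL_m(ℂ), GL_m(ℂ)]`): a transvection `t_{ij}(s)` is conjugate (by `diag(1,…,2,…,1)`) to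
`t_{ij}(2s) = t_{ij}(s)²`, so its image `x` satisfies `x = x²`; the one-entry diagonal matrices at
different positions are conjugate by permutation matrices, so a diagonal matrix of determinant `1`
maps to `ψ(∏ d_i) = ψ(1) = 1`; transvections and such diagonal matrices generate
(`Matrix.diagonal_transvection_induction`). A standard fact, proved here as the second
group-theoretic input of BI 2017 Lemma 3.19 (the unit character of a divisor of `P_{D,m}` is trivial
on `SL_m`). [cite: BurgisserIkenmeyer2017, Lemma 3.19 (proof)] -/
theorem GL_monoidHom_comm_apply_toGL_eq_one {A : Type*} [CommGroup A]
    (c : GL (Fin m) ℂ →* A) (g : Matrix.SpecialLinearGroup (Fin m) ℂ) :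
    c (Matrix.SpecialLinearGroup.toGL g) = 1 := by
  classical
  -- conjugation: `c (p h) = c (h' p)` gives `c h = c h'`
  have hswap : ∀ p h h' : GL (Fin m) ℂ, p * h = h' * p → c h = c h' := by
    intro p h h' hp
    have := congrArg c hp
    rw [map_mul, map_mul, mul_comm (c h')] at this
    exact mul_left_cancel this
  -- (1) transvections
  have htrans : ∀ (i j : Fin m) (hij : i ≠ j) (s : ℂ) (hs : (transvection i j s).det ≠ 0),
      c (Matrix.GeneralLinearGroup.mkOfDetNeZero (transvection i j s) hs) = 1 := by
    intro i j hij s hs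
    have hd : (diagonal (Function.update (1 : Fin m → ℂ) i 2)).det ≠ 0 := by
      rw [det_diagonal]
      refine Finset.prod_ne_zero_iff.mpr fun a _ => ?_
      rw [Function.update_apply]
      split_ifs <;> norm_num
    have h2s : (transvection i j (2 * s)).det ≠ 0 := by
      rw [det_transvection_of_ne _ _ hij]; exact one_ne_zero
    have hsq : Matrix.GeneralLinearGroup.mkOfDetNeZero (transvection i j s) hs *
        Matrix.GeneralLinearGroup.mkOfDetNeZero (transvection i j s) hs =
          Matrix.GeneralLinearGroup.mkOfDetNeZero (transvection i j (2 * s)) h2s := by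
      apply Units.ext
      change transvection i j s * transvection i j s = transvection i j (2 * s)
      rw [transvection_mul_transvection_same i j hij, two_mul]
    have hcj : Matrix.GeneralLinearGroup.mkOfDetNeZero _ hd *
        Matrix.GeneralLinearGroup.mkOfDetNeZero (transvection i j s) hs =
          Matrix.GeneralLinearGroup.mkOfDetNeZero (transvection i j (2 * s)) h2s *
            Matrix.GeneralLinearGroup.mkOfDetNeZero _ hd := by
      apply Units.ext
      exact diagonal_update_two_mul_transvection hij s
    have key := hswap _ _ _ hcj
    rw [← hsq, map_mul] at key
    -- key : x = x * x
    exact (mul_eq_left.mp key.symm)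
  -- (2) the torus `δ : (Fin m → ℂˣ) →* GL`
  let δ : (Fin m → ℂˣ) →* GL (Fin m) ℂ :=
    (Units.map (Matrix.diagonalRingHom (Fin m) ℂ : (Fin m → ℂ) →+* Matrix (Fin m) (Fin m) ℂ).toMonoidHom).comp
      (MulEquiv.piUnits (M := fun _ : Fin m => ℂ)).symm.toMonoidHom
  have hδ : ∀ D : Fin m → ℂˣ, ((δ D : GL (Fin m) ℂ) : Matrix (Fin m) (Fin m) ℂ) =
      diagonal fun i => (D i : ℂ) := fun D => rfl
  -- one-entry diagonal matrices at `i` and `j` are conjugate by the permutation matrix of `swap i j`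
  have hψ : ∀ (i j : Fin m) (x : ℂˣ), c (δ (Pi.mulSingle i x)) = c (δ (Pi.mulSingle j x)) := by
    intro i j x
    have hP : ((Equiv.swap i j).permMatrix ℂ).det ≠ 0 := by
      rw [det_permutation]
      exact Int.cast_ne_zero.mpr (Units.ne_zero _)
    refine hswap (Matrix.GeneralLinearGroup.mkOfDetNeZero _ hP) _ _ (Units.ext ?_)
    change (Equiv.swap i j).permMatrix ℂ * ((δ (Pi.mulSingle i x) : GL (Fin m) ℂ) : Matrix _ _ ℂ) =
      ((δ (Pi.mulSingle j x) : GL (Fin m) ℂ) : Matrix _ _ ℂ) * (Equiv.swap i j).permMatrix ℂ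
    rw [hδ, hδ, permMatrix_mul_diagonal]
    congr 2
    funext a
    simp only [Function.comp_apply, Pi.mulSingle_apply]
    by_cases ha : a = j
    · subst ha
      rw [Equiv.swap_apply_right, if_pos rfl, if_pos rfl]
    · rw [if_neg ha, if_neg]
      intro h'
      apply ha
      have h'' := congrArg (Equiv.swap i j) h'
      rwa [Equiv.swap_apply_self, Equiv.swap_apply_left] at h''
  -- (3) diagonal matrices of determinant one
  have htorus : ∀ D : Fin m → ℂˣ, (∏ i, D i) = 1 → c (δ D) = 1 := by
    intro D hD
    rcases isEmpty_or_nonempty (Fin m) with hm | ⟨⟨i₀⟩⟩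
    · rw [Subsingleton.elim D 1, map_one, map_one]
    · -- `ψ = c ∘ δ ∘ mulSingle i₀ : ℂˣ →* A`
      let ψ : ℂˣ →* A := (c.comp δ).comp (MonoidHom.mulSingle (fun _ : Fin m => ℂˣ) i₀)
      have hψ' : ∀ (i : Fin m) (x : ℂˣ), c (δ (Pi.mulSingle i x)) = ψ x := fun i x => hψ i i₀ x
      calc c (δ D) = c (δ (∏ i, Pi.mulSingle i (D i))) := by rw [Finset.univ_prod_mulSingle]
        _ = ∏ i, c (δ (Pi.mulSingle i (D i))) := map_prod (c.comp δ) _ _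
        _ = ∏ i, ψ (D i) := Finset.prod_congr rfl fun i _ => hψ' i (D i)
        _ = ψ (∏ i, D i) := (map_prod ψ _ _).symm
        _ = 1 := by rw [hD, map_one]
  -- (4) generation: `Matrix.diagonal_transvection_induction` with determinant-one diagonal matrices
  have hdet1 : ((Matrix.SpecialLinearGroup.toGL g : GL (Fin m) ℂ) : Matrix (Fin m) (Fin m) ℂ).det = 1 := by
    rw [Matrix.SpecialLinearGroup.coe_GL_coe_matrix]
    exact g.det_coe
  have H : ∀ hM : ((Matrix.SpecialLinearGroup.toGL g : GL (Fin m) ℂ) : Matrix (Fin m) (Fin m) ℂ).det ≠ 0,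
      c (Matrix.GeneralLinearGroup.mkOfDetNeZero _ hM) = 1 := by
    refine Matrix.diagonal_transvection_induction
      (fun M => ∀ hM : M.det ≠ 0, c (Matrix.GeneralLinearGroup.mkOfDetNeZero M hM) = 1) _ ?_ ?_ ?_
    · intro D hD hM
      have hDi : ∀ i, D i ≠ 0 := by
        intro i hi
        apply hM
        rw [det_diagonal]
        exact Finset.prod_eq_zero (Finset.mem_univ i) hi
      have heq : Matrix.GeneralLinearGroup.mkOfDetNeZero (diagonal D) hM =
          δ (fun i => Units.mk0 (D i) (hDi i)) := Units.ext rfl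
      rw [heq]
      refine htorus _ (Units.ext ?_)
      rw [Units.coe_prod, Units.val_one]
      change ∏ i, D i = 1
      rw [← det_diagonal, hD, hdet1]
    · intro t hM
      exact htrans t.i t.j t.hij t.c hM
    · intro A B hPA hPB hAB
      have hA : A.det ≠ 0 := fun h => hAB (by rw [det_mul, h, zero_mul])
      have hB : B.det ≠ 0 := fun h => hAB (by rw [det_mul, h, mul_zero])
      have heq : Matrix.GeneralLinearGroup.mkOfDetNeZero (A * B) hAB =
          Matrix.GeneralLinearGroup.mkOfDetNeZero A hA *
            Matrix.GeneralLinearGroup.mkOfDetNeZero B hB :=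
        Units.ext rfl
      rw [heq, map_mul, hPA hA, hPB hB, one_mul]
  have hg : Matrix.GeneralLinearGroup.mkOfDetNeZero _ (hdet1.symm ▸ one_ne_zero) =
      Matrix.SpecialLinearGroup.toGL g := Units.ext rfl
  rw [← hg]
  exact H _

end GLHoms


/-! ### Divisors of a `GL`-semi-invariant polynomial function are `GL`-semi-invariant -/

section Divisors

open MvPolynomial

variable {m D : ℕ}

/-- `coordSubst` preserves associatedness. [folklore] -/
private theorem associated_coordSubst (g : GL (Fin m) ℂ) {a b : MvPolynomial (DegIdx (Fin m) D) ℂ}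
    (h : Associated a b) : Associated (coordSubst D g a) (coordSubst D g b) := by
  obtain ⟨u, rfl⟩ := h
  exact ⟨Units.map (coordSubst D g : MvPolynomial (DegIdx (Fin m) D) ℂ →* _) u,
    by rw [map_mul, Units.coe_map]; rfl⟩

/-- **Divisors of a `GL_m`-semi-invariant are carried to associates by `GL_m`.** If a nonzero
polynomial function `P` on `Sym^D ℂ^m` satisfies `g · P ~ P` (associated) for every `g ∈ GL_m`, then
so does every divisor `a` of `P`: `GL_m(ℂ)` permutes the finitely many classes of divisors of `P` in
the unique factorization domain `ℂ[Sym^D]` (`UniqueFactorizationMonoid.fintypeSubtypeDvd` on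
`Associates`), and a homomorphism from `GL_m(ℂ)` to a finite group is trivial
(`GL_monoidHom_eq_one_of_finite`). The classical fact "factors of a semi-invariant of a connected
group are semi-invariants" in the form needed for BI 2017 Lemma 3.19 (Ottaviani 2009, p. 105).
[cite: BurgisserIkenmeyer2017, Lemma 3.19 (proof)] -/
theorem associated_coordSubst_of_dvd {P : MvPolynomial (DegIdx (Fin m) D) ℂ} (hP : P ≠ 0)
    (hinv : ∀ g : GL (Fin m) ℂ, Associated (coordSubst D g P) P) {a : MvPolynomial (DegIdx (Fin m) D) ℂ}
    (ha : a ∣ P) (g : GL (Fin m) ℂ) : Associated (coordSubst D g a) a := by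
  classical
  -- the finite type of classes of divisors of `P`
  let T := {x : Associates (MvPolynomial (DegIdx (Fin m) D) ℂ) // x ∣ Associates.mk P}
  haveI : Fintype T :=
    UniqueFactorizationMonoid.fintypeSubtypeDvd _ (Associates.mk_ne_zero.mpr hP)
  -- the action of `GL` on `Associates`
  let F : GL (Fin m) ℂ → Associates (MvPolynomial (DegIdx (Fin m) D) ℂ) →
      Associates (MvPolynomial (DegIdx (Fin m) D) ℂ) := fun g =>
    Quotient.map (coordSubst D g) fun a b (h : Associated a b) => associated_coordSubst g h
  have hFmk : ∀ (g : GL (Fin m) ℂ) (a : MvPolynomial (DegIdx (Fin m) D) ℂ),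
      F g (Associates.mk a) = Associates.mk (coordSubst D g a) := fun g a => rfl
  have hF1 : ∀ x, F 1 x = x := by
    intro x
    induction x using Quotient.inductionOn with
    | h a => change F 1 (Associates.mk a) = Associates.mk a; rw [hFmk, coordSubst_one]; rfl
  have hFmul : ∀ g h x, F (g * h) x = F g (F h x) := by
    intro g h x
    induction x using Quotient.inductionOn with
    | h a =>
      change F (g * h) (Associates.mk a) = F g (F h (Associates.mk a))
      rw [hFmk, hFmk, hFmk, coordSubst_mul]
      rfl
  -- `F g` maps divisor classes of `P` to divisor classes of `P`
  have hFT : ∀ (g : GL (Fin m) ℂ) (x : T), F g x.1 ∣ Associates.mk P := by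
    rintro g ⟨x, hx⟩
    induction x using Quotient.inductionOn with
    | h b =>
      change F g (Associates.mk b) ∣ Associates.mk P
      rw [hFmk, Associates.mk_dvd_mk]
      have hb : b ∣ P := Associates.mk_dvd_mk.mp hx
      exact (hinv g).dvd_iff_dvd_right.mp (map_dvd (coordSubst D g) hb)
  -- the permutation representation
  let σ : GL (Fin m) ℂ → Equiv.Perm T := fun g =>
    { toFun := fun x => ⟨F g x.1, hFT g x⟩
      invFun := fun x => ⟨F g⁻¹ x.1, hFT g⁻¹ x⟩
      left_inv := fun x => Subtype.ext (by
        change F g⁻¹ (F g x.1) = x.1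
        rw [← hFmul, inv_mul_cancel, hF1])
      right_inv := fun x => Subtype.ext (by
        change F g (F g⁻¹ x.1) = x.1
        rw [← hFmul, mul_inv_cancel, hF1]) }
  let π : GL (Fin m) ℂ →* Equiv.Perm T :=
    { toFun := σ
      map_one' := Equiv.ext fun x => Subtype.ext (hF1 x.1)
      map_mul' := fun g h => Equiv.ext fun x => Subtype.ext (hFmul g h x.1) }
  have hπ : π g = 1 := GL_monoidHom_eq_one_of_finite π g
  have hx : σ g ⟨Associates.mk a, Associates.mk_dvd_mk.mpr ha⟩ =
      ⟨Associates.mk a, Associates.mk_dvd_mk.mpr ha⟩ := by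
    change π g _ = _
    rw [hπ]
    rfl
  have hx' := congrArg Subtype.val hx
  change F g (Associates.mk a) = Associates.mk a at hx'
  rw [hFmk, Associates.mk_eq_mk_iff_associated] at hx'
  exact hx'

end Divisors


/-! ### From "associated for all of `GL`" to "fixed by `SL`" -/

section Character

open MvPolynomial

variable {m D : ℕ}

/-- Cancelling a nonzero polynomial: `C r * a = C r' * a ⇒ r = r'`. [folklore] -/
private theorem C_mul_cancel {a : MvPolynomial (DegIdx (Fin m) D) ℂ} (ha : a ≠ 0) {r r' : ℂ}
    (h : C r * a = C r' * a) : r = r' :=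
  C_injective _ _ (mul_right_cancel₀ ha h)

/-- **A polynomial function carried to associates by all of `GL_m(ℂ)` is fixed by `SL_m(ℂ)`.** The
units `c_g ∈ ℂ^×` with `g · a = c_g a` form a homomorphism `GL_m(ℂ) → ℂ^×`, which is trivial on
`SL_m(ℂ)` (`GL_monoidHom_comm_apply_toGL_eq_one`). [cite: BurgisserIkenmeyer2017, Lemma 3.19 (proof)] -/
theorem isSLInvariantCoord_of_forall_associated_coordSubst {a : MvPolynomial (DegIdx (Fin m) D) ℂ}
    (ha : a ≠ 0) (hass : ∀ g : GL (Fin m) ℂ, Associated (coordSubst D g a) a) :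
    IsSLInvariantCoord D a := by
  classical
  -- the unit scalars
  have hex : ∀ g : GL (Fin m) ℂ, ∃ r : ℂ, r ≠ 0 ∧ coordSubst D g a = C r * a := by
    intro g
    obtain ⟨u, hu⟩ := hass g
    obtain ⟨r, hr, hur⟩ := (MvPolynomial.isUnit_iff_eq_C_of_isReduced (P := ((u⁻¹ : _ˣ) :
      MvPolynomial (DegIdx (Fin m) D) ℂ))).mp (u⁻¹).isUnit
    refine ⟨r, hr.ne_zero, ?_⟩
    calc coordSubst D g a = coordSubst D g a * ↑u * ↑u⁻¹ := by
          rw [mul_assoc, Units.mul_inv, mul_one]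
      _ = a * ↑u⁻¹ := by rw [hu]
      _ = C r * a := by rw [hur, mul_comm]
  choose r hr0 hr using hex
  -- they form a homomorphism `GL → ℂˣ`
  have hmul : ∀ g h, r (g * h) = r g * r h := by
    intro g h
    apply C_mul_cancel ha
    rw [← hr, coordSubst_mul, AlgHom.comp_apply, hr h, map_mul, MvPolynomial.algHom_C,
      MvPolynomial.algebraMap_eq, hr g, ← mul_assoc, ← map_mul, mul_comm (r h)]
  have hone : r 1 = 1 := by
    apply C_mul_cancel ha
    rw [← hr, coordSubst_one, map_one, one_mul]
    rfl
  let c : GL (Fin m) ℂ →* ℂˣ :=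
    { toFun := fun g => Units.mk0 (r g) (hr0 g)
      map_one' := Units.ext hone
      map_mul' := fun g h => Units.ext (hmul g h) }
  intro s
  have hc : c (Matrix.SpecialLinearGroup.toGL s) = 1 := GL_monoidHom_comm_apply_toGL_eq_one c s
  have hr1 : r (Matrix.SpecialLinearGroup.toGL s) = 1 := by
    have := congrArg Units.val hc
    exact this
  rw [coordRep_apply, hr, hr1, map_one, one_mul]

end Character

/-! ### `GL`-semi-invariance of Cayley's `P_{D,m}` and invariance of homogeneous components -/

section CayleySemiInvariant

open MvPolynomial

variable {m D : ℕ}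

/-- **`P_{D,m}` is a `GL_m`-semi-invariant polynomial function with character `det^{-D}`**
(BI 2017 Thm. 3.18(1), `P_{D,m}(gv) = det(g)^D P_{D,m}(v)`, as a POLYNOMIAL identity for the
coordinate action `(g·F)(v) = F(g⁻¹ v)`): `g · P_{D,m} = det(g⁻¹)^D · P_{D,m}`.
[cite: BurgisserIkenmeyer2017, Thm. 3.18(1)] -/
theorem coordSubst_cayleyP (g : GL (Fin m) ℂ) :
    coordSubst D g (cayleyP (k := ℂ) D (Equiv.refl (Fin m))) =
      C ((((g⁻¹ : GL (Fin m) ℂ) : Matrix (Fin m) (Fin m) ℂ).det) ^ D) *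
        cayleyP (k := ℂ) D (Equiv.refl (Fin m)) := by
  apply MvPolynomial.funext
  intro w
  obtain ⟨q, hq, rfl⟩ := exists_formCoeff_eq (k := ℂ) w
  change aeval (formCoeff D q) (coordSubst D g (cayleyP (k := ℂ) D (Equiv.refl (Fin m)))) =
    aeval (formCoeff D q) (C ((((g⁻¹ : GL (Fin m) ℂ) : Matrix (Fin m) (Fin m) ℂ).det) ^ D) *
      cayleyP (k := ℂ) D (Equiv.refl (Fin m)))
  rw [aeval_formCoeff_coordSubst, linSubstRep_apply, BI2017_thm_3_18_1 _ hq, map_mul,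
    MvPolynomial.aeval_C, Algebra.algebraMap_self_apply]

/-- Hence `g · P_{D,m} ~ P_{D,m}` (associated) for every `g ∈ GL_m(ℂ)`. [cite: BurgisserIkenmeyer2017, Thm. 3.18(1)] -/
theorem associated_coordSubst_cayleyP (g : GL (Fin m) ℂ) :
    Associated (coordSubst D g (cayleyP (k := ℂ) D (Equiv.refl (Fin m))))
      (cayleyP (k := ℂ) D (Equiv.refl (Fin m))) := by
  rw [coordSubst_cayleyP]
  exact associated_unit_mul_left _ _
    ((isUnit_iff_ne_zero.mpr (pow_ne_zero _ (Matrix.GeneralLinearGroup.det_ne_zero _))).map C)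

end CayleySemiInvariant



section Graded

open MvPolynomial

variable {m D : ℕ}

/-- `coordSubst` commutes with taking homogeneous components. [folklore] -/
private theorem homogeneousComponent_coordSubst (g : GL (Fin m) ℂ)
    (F : MvPolynomial (DegIdx (Fin m) D) ℂ) (i : ℕ) :
    homogeneousComponent i (coordSubst D g F) = coordSubst D g (homogeneousComponent i F) := by
  conv_lhs => rw [← sum_homogeneousComponent (φ := F)]
  rw [map_sum, map_sum, Finset.sum_eq_single i]
  · rw [homogeneousComponent_of_mem ((mem_homogeneousSubmodule _ _).mpr
      (isHomogeneous_coordSubst g (homogeneousComponent_isHomogeneous i F))), if_pos rfl]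
  · intro j _ hji
    rw [homogeneousComponent_of_mem ((mem_homogeneousSubmodule _ _).mpr
      (isHomogeneous_coordSubst g (homogeneousComponent_isHomogeneous j F))), if_neg (Ne.symm hji)]
  · intro hi
    have hlt : F.totalDegree < i := by
      rw [Finset.mem_range, not_lt] at hi
      omega
    rw [MvPolynomial.homogeneousComponent_eq_zero _ _ hlt, map_zero, map_zero]

/-- **Homogeneous components of an `SL_m`-invariant polynomial function are `SL_m`-invariant**
(the coordinate action is graded; the tree's `isHomogeneous_coordSubst`). [cite: BurgisserIkenmeyer2017, §3 (the graded invariant ring `O(Sym^D ℂ^m)^{SL_m}_d`)] -/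
theorem IsSLInvariantCoord.homogeneousComponent {F : MvPolynomial (DegIdx (Fin m) D) ℂ}
    (hF : IsSLInvariantCoord D F) (i : ℕ) :
    IsSLInvariantCoord D (MvPolynomial.homogeneousComponent i F) := by
  intro s
  rw [coordRep_apply, ← homogeneousComponent_coordSubst, ← coordRep_apply, hF s]

end Graded

/-! ### Lemma 3.19 discharged -/

section LemmaThreeNineteen

open MvPolynomial

/-- **BI 2017, Lemma 3.19 — DISCHARGED** (`\\label{le:irred}`, L1232–1241, p0011:L70): "`P_{D,m}` is an
irreducible polynomial of degree `m` if `D` is even." Printed proof: "directly derived from the fact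
that, by Theorem 3.14 [Howe], `P_{D,m}` is a nonzero `SL_m`-invariant on `Sym^D ℂ^m` of smallest degree
(for an analog argument see Ottaviani 2009, p. 105)". Formalised: if `P_{D,m} = a · b`, the divisor
`a` is carried to associates by all of `GL_m(ℂ)` (`associated_coordSubst_of_dvd`, since `P_{D,m}` is a
`GL_m`-semi-invariant, `associated_coordSubst_cayleyP`), hence is `SL_m`-invariant
(`isSLInvariantCoord_of_forall_associated_coordSubst`), and so are its homogeneous components; a
nonzero one of degree `0 < i ≤ deg a < m` contradicts Howe's theorem (`BI2017_thm_3_14_holds`,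
discharged in `BI17HoweInvariantsProofs.lean`) unless `a` or `b` is a constant. (`m = 1`: degree count
alone.) [cite: BurgisserIkenmeyer2017, Lemma 3.19] -/
theorem BI2017_lem_3_19_holds : BI2017_lem_3_19 := by
  intro D m hD hD0 hm1
  have hPhom : (cayleyP (k := ℂ) D (Equiv.refl (Fin m))).IsHomogeneous m :=
    isHomogeneous_hyperdetPoly _
  have hP0 : cayleyP (k := ℂ) D (Equiv.refl (Fin m)) ≠ 0 := by
    intro h
    have hv := BI2017_thm_3_18_2_powerSum (k := ℂ) (σ := Fin m) hD hD0 (Equiv.refl (Fin m))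
    rw [h, map_zero] at hv
    exact Nat.cast_ne_zero.mpr (Nat.factorial_ne_zero m) hv.symm
  have hPdeg : (cayleyP (k := ℂ) D (Equiv.refl (Fin m))).totalDegree = m := hPhom.totalDegree hP0
  -- non-units have positive total degree
  have hdeg_pos : ∀ a : MvPolynomial (DegIdx (Fin m) D) ℂ, a ≠ 0 → ¬ IsUnit a →
      0 < a.totalDegree := by
    intro a ha hu
    by_contra h0
    have h0' : a.totalDegree = 0 := by omega
    rw [totalDegree_eq_zero_iff_eq_C] at h0'
    apply hu
    rw [h0']
    refine (isUnit_iff_ne_zero.mpr ?_).map C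
    intro hc
    apply ha
    rw [h0', hc, map_zero]
  refine ⟨fun hu => ?_, fun a b hab => ?_⟩
  · -- `P_{D,m}` is not a unit
    obtain ⟨r, -, hr⟩ := MvPolynomial.isUnit_iff_eq_C_of_isReduced.mp hu
    have h0 : (cayleyP (k := ℂ) D (Equiv.refl (Fin m))).IsHomogeneous 0 := by
      rw [hr]
      exact isHomogeneous_C _ _
    have := hPhom.inj_right h0 hP0
    omega
  · -- a factorisation `P_{D,m} = a * b`
    by_contra hcon
    push Not at hcon
    obtain ⟨hua, hub⟩ := hcon
    have ha0 : a ≠ 0 := by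
      rintro rfl
      exact hP0 (by rw [hab, zero_mul])
    have hb0 : b ≠ 0 := by
      rintro rfl
      exact hP0 (by rw [hab, mul_zero])
    have hda := hdeg_pos a ha0 hua
    have hdb := hdeg_pos b hb0 hub
    have hsum : a.totalDegree + b.totalDegree = m := by
      rw [← totalDegree_mul_of_isDomain ha0 hb0, ← hab, hPdeg]
    -- `a` is `SL_m`-invariant
    have hainv : IsSLInvariantCoord D a :=
      isSLInvariantCoord_of_forall_associated_coordSubst ha0 fun g =>
        associated_coordSubst_of_dvd hP0 associated_coordSubst_cayleyP ⟨b, hab⟩ g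
    -- a nonzero homogeneous component of `a` of positive degree
    obtain ⟨i, hi0, hile, hci⟩ :
        ∃ i, 0 < i ∧ i ≤ a.totalDegree ∧ homogeneousComponent i a ≠ 0 := by
      by_contra hnone
      push Not at hnone
      have ha_eq : a = homogeneousComponent 0 a := by
        conv_lhs => rw [← sum_homogeneousComponent (φ := a)]
        rw [Finset.sum_eq_single 0]
        · intro j hj hj0
          exact hnone j (Nat.pos_of_ne_zero hj0)
            (Nat.lt_succ_iff.mp (Finset.mem_range.mp hj))
        · intro h
          exact absurd (Finset.mem_range.mpr (Nat.succ_pos _)) h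
      rw [homogeneousComponent_zero] at ha_eq
      have : a.totalDegree = 0 := by
        rw [ha_eq]
        exact totalDegree_C _
      omega
    -- Howe: no nonzero homogeneous `SL_m`-invariant in degrees `0 < i < m`
    have him : i < m := by omega
    have hm2 : 2 ≤ m := by omega
    have hbot := (BI2017_thm_3_14_holds D m hD0 hm2).1 i hi0 him
    have hmem : homogeneousComponent i a ∈ slInvariantsOfDegree (Fin m) ℂ D i :=
      (mem_slInvariantsOfDegree_iff D i _).mpr
        ⟨homogeneousComponent_isHomogeneous i a, hainv.homogeneousComponent i⟩
    rw [hbot, Submodule.mem_bot] at hmem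
    exact hci hmem

end LemmaThreeNineteen

end Literature.Computability.AlgebraicComplexity
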